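import Literature.Probability.LatticeModels.WeaklyCoupledChainStep
import Literature.Probability.LatticeModels.WeaklyCoupledChainPartials
import Mathlib.Analysis.SpecificLimits.Basic
import HarnessLib

/-!
# Weakly coupled chains: uniform Poincaré inequality and exponential decay of correlations

`Literature/Probability/LatticeModels/` — fourth file of the `WeaklyCoupledChain*` series. With
`a_k = E_0[(E_{k+1}f - E_k f)²]` (the variances of the martingale increments of `f` along the
coordinate filtration), `b_k = E_0[(∂_k f)²]`, `A = 2ρ₀⁶L²`, `θ = 2ρ₀⁴(ρ₀-1)²`, the one-step
bound of `WeaklyCoupledChainStep.lean` integrates to the recursion `a_k ≤ A b_k + θ a_{k+1}`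
(`recursion`); the increments are orthogonal (`condExp_zero_incr_mul_incr_eq_zero`) and
`Var f = ∑_k a_k` (`condExp_zero_sq_centered_eq_sum`). Consequences, for `θ < 1`
(weak coupling), all uniform in `N` and [folklore]:

* `variance_le` — the uniform Poincaré inequality `Var(f) ≤ (A/(1-θ)) ∑_k E_0[(∂_k f)²]`;
* `condExp_zero_sq_incr_le_pow_mul` — for `g` depending only on the coordinates `≥ l`,
  `a_k(g) ≤ θ^{l-k} Var(g)`;
* `abs_cov_le_sqrt_var` — exponential decay of correlations: for `f` depending on the first `m`
  coordinates and `g` on the coordinates `≥ l`,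
  `|E_0[(f - E_0f)(g - E_0g)]| ≤ (1-θ)^{-1/2} (√θ)^{(l+1-m)₊} √Var(f) √Var(g)`.

Observables enter with their partial derivatives through `BoxChain.HasPartials`
(`WeaklyCoupledChainPartials.lean`). No definitions.
-/

noncomputable section

open MeasureTheory Function Set Filter
open scoped ENNReal Topology

namespace Literature.Probability.LatticeModels

namespace BoxChain

variable {N : ℕ}

namespace Spec

variable (S : Spec N)

/-! ### Expectations: the level `0` -/

section Mean

/-- `E_0 h` is a constant function (the expectation `ν(h)`). [folklore] -/
theorem condExp_zero_apply (h : (Fin N → ℝ) → ℝ) (q : Fin N → ℝ) : S.condExp 0 h q = S.condExp 0 h 0 :=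
  S.dependsOn_condExp 0 h fun _ hi => absurd hi (Nat.not_lt_zero _)

/-- `E_k` of a finite sum. [folklore] -/
theorem condExp_finset_sum (k : ℕ) {ι : Type*} (s : Finset ι) {F : ι → (Fin N → ℝ) → ℝ}
    (hF : ∀ i ∈ s, Continuous (F i)) :
    S.condExp k (fun p => ∑ i ∈ s, F i p) = fun p => ∑ i ∈ s, S.condExp k (F i) p := by
  classical
  induction s using Finset.induction_on with
  | empty => simp [S.condExp_const k 0]
  | insert a s ha ih =>
    have hFa : Continuous (F a) := hF a (Finset.mem_insert_self a s)
    have hFs : ∀ i ∈ s, Continuous (F i) := fun i hi => hF i (Finset.mem_insert_of_mem hi)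
    have hsum : Continuous fun p => ∑ i ∈ s, F i p := continuous_finsetSum s fun i hi => hFs i hi
    simp_rw [Finset.sum_insert ha]
    have hadd := S.condExp_add k (f := F a) (g := fun p => ∑ i ∈ s, F i p) hFa hsum
    have e : (fun p => F a p + ∑ i ∈ s, F i p) = (F a + fun p => ∑ i ∈ s, F i p) := rfl
    rw [e, hadd, ih hFs]
    rfl

/-- **Conditional Cauchy–Schwarz**: `(E_k[XY])² ≤ E_k[X²] E_k[Y²]`. [folklore] -/
theorem sq_condExp_mul_le (k : ℕ) {X Y : (Fin N → ℝ) → ℝ} (hX : Continuous X) (hY : Continuous Y)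
    (q : Fin N → ℝ) :
    (S.condExp k (fun p => X p * Y p) q) ^ 2 ≤
      S.condExp k (fun p => X p ^ 2) q * S.condExp k (fun p => Y p ^ 2) q := by
  set I := S.condExp k (fun p => X p * Y p) q with hI
  set P := S.condExp k (fun p => X p ^ 2) q with hP
  set Q := S.condExp k (fun p => Y p ^ 2) q with hQ
  have hQ0 : 0 ≤ Q := S.condExp_nonneg k (fun _ => sq_nonneg _) q
  have hP0 : 0 ≤ P := S.condExp_nonneg k (fun _ => sq_nonneg _) q
  have hquad : ∀ m : ℝ, 0 ≤ P - 2 * m * I + m ^ 2 * Q := by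
    intro m
    have h0 : 0 ≤ S.condExp k (fun p => (X p - m * Y p) ^ 2) q := S.condExp_nonneg k (fun _ => sq_nonneg _) q
    have e : (fun p => (X p - m * Y p) ^ 2) =
        ((fun p => X p ^ 2) - fun p => (2 * m) * (X p * Y p)) + fun p => m ^ 2 * Y p ^ 2 := by
      funext p; simp only [Pi.add_apply, Pi.sub_apply]; ring
    rw [e, S.condExp_add k (f := (fun p => X p ^ 2) - fun p => (2 * m) * (X p * Y p))
        (g := fun p => m ^ 2 * Y p ^ 2) ((hX.pow 2).sub (continuous_const.mul (hX.mul hY)))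
        (continuous_const.mul (hY.pow 2)),
      S.condExp_sub k (f := fun p => X p ^ 2) (g := fun p => (2 * m) * (X p * Y p)) (hX.pow 2)
        (continuous_const.mul (hX.mul hY)),
      S.condExp_mul_left k (g := fun _ => 2 * m) (fun _ _ _ => rfl) (fun p => X p * Y p),
      S.condExp_mul_left k (g := fun _ => m ^ 2) (fun _ _ _ => rfl) (fun p => Y p ^ 2)] at h0
    simp only [Pi.add_apply, Pi.sub_apply] at h0
    rw [← hI, ← hP, ← hQ] at h0
    linarith
  rcases hQ0.eq_or_lt with hQ0' | hQpos
  · rw [← hQ0', mul_zero]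
    have hI0 : I = 0 := by
      by_contra hne
      have h1 := hquad ((P + 1) / (2 * I))
      rw [← hQ0'] at h1
      have : 2 * ((P + 1) / (2 * I)) * I = P + 1 := by field_simp
      nlinarith
    rw [hI0]; norm_num
  · have h1 := hquad (I / Q)
    have e : P - 2 * (I / Q) * I + (I / Q) ^ 2 * Q = P - I ^ 2 / Q := by
      field_simp; ring
    rw [e] at h1
    have h2 : I ^ 2 / Q ≤ P := by linarith
    rw [div_le_iff₀ hQpos] at h2
    linarith

/-- `|E_k[XY]| ≤ √(E_k[X²]) √(E_k[Y²])`. [folklore] -/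
theorem abs_condExp_mul_le (k : ℕ) {X Y : (Fin N → ℝ) → ℝ} (hX : Continuous X) (hY : Continuous Y)
    (q : Fin N → ℝ) :
    |S.condExp k (fun p => X p * Y p) q| ≤
      Real.sqrt (S.condExp k (fun p => X p ^ 2) q) * Real.sqrt (S.condExp k (fun p => Y p ^ 2) q) := by
  rw [← Real.sqrt_mul (S.condExp_nonneg k (fun _ => sq_nonneg _) q), ← Real.sqrt_sq_eq_abs]
  exact Real.sqrt_le_sqrt (S.sq_condExp_mul_le k hX hY q)

end Mean

/-! ### Martingale increments: orthogonality and the variance decomposition -/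

section Increments

/-- **Orthogonality of increments**: for `j < k`,
`E_0[(E_{j+1}f - E_j f)(E_{k+1}g - E_k g)] = 0`. [folklore] -/
theorem condExp_zero_incr_mul_incr_eq_zero {j k : ℕ} (hjk : j < k) {f g : (Fin N → ℝ) → ℝ}
    (hf : Continuous f) (hg : Continuous g) (q : Fin N → ℝ) :
    S.condExp 0 (fun p => (S.condExp (j + 1) f p - S.condExp j f p) * (S.condExp (k + 1) g p - S.condExp k g p)) q = 0 := by
  have hXc : Continuous fun p => S.condExp (j + 1) f p - S.condExp j f p :=
    (S.continuous_condExp _ hf).sub (S.continuous_condExp _ hf)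
  have hYc : Continuous fun p => S.condExp (k + 1) g p - S.condExp k g p :=
    (S.continuous_condExp _ hg).sub (S.continuous_condExp _ hg)
  -- `E_k` of the product: pull out the first factor, the second has `E_k`-mean zero
  have hdep : DependsOn (fun p => S.condExp (j + 1) f p - S.condExp j f p) {i : Fin N | i.val < k} := by
    intro p p' hpp'
    have h1 := S.dependsOn_condExp (j + 1) f fun i hi => hpp' i (by simp only [Set.mem_setOf_eq] at hi ⊢; omega)
    have h2 := S.dependsOn_condExp j f fun i hi => hpp' i (by simp only [Set.mem_setOf_eq] at hi ⊢; omega)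
    simp only [h1, h2]
  have hzero : S.condExp k (fun p => S.condExp (k + 1) g p - S.condExp k g p) = fun _ => 0 := by
    show S.condExp k (S.condExp (k + 1) g - S.condExp k g) = _
    rw [S.condExp_sub k (f := S.condExp (k + 1) g) (g := S.condExp k g) (S.continuous_condExp _ hg)
      (S.continuous_condExp _ hg), S.condExp_condExp_succ k hg,
      S.condExp_of_dependsOn k (S.dependsOn_condExp k g)]
    funext p; simp
  have hk : S.condExp k (fun p => (S.condExp (j + 1) f p - S.condExp j f p) *
      (S.condExp (k + 1) g p - S.condExp k g p)) = fun _ => 0 := by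
    rw [S.condExp_mul_left k hdep, hzero]
    funext p; simp
  rw [← S.condExp_zero_condExp k
    (h := fun p => (S.condExp (j + 1) f p - S.condExp j f p) * (S.condExp (k + 1) g p - S.condExp k g p))
    (hXc.mul hYc), hk, S.condExp_const]

/-- **Telescoping**: `f - E_0 f = ∑_{k<N} (E_{k+1} f - E_k f)`. [folklore] -/
theorem sub_condExp_zero_eq_sum (f : (Fin N → ℝ) → ℝ) (p : Fin N → ℝ) :
    f p - S.condExp 0 f p = ∑ k ∈ Finset.range N, (S.condExp (k + 1) f p - S.condExp k f p) := by
  have h := Finset.sum_range_sub (fun k => S.condExp k f p) N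
  rw [h, S.condExp_of_le le_rfl]

/-- **Covariance decomposition**:
`E_0[(f - E_0 f)(g - E_0 g)] = ∑_{k<N} E_0[(E_{k+1}f - E_k f)(E_{k+1}g - E_k g)]`. [folklore] -/
theorem condExp_zero_mul_centered_eq_sum {f g : (Fin N → ℝ) → ℝ} (hf : Continuous f) (hg : Continuous g)
    (q : Fin N → ℝ) :
    S.condExp 0 (fun p => (f p - S.condExp 0 f p) * (g p - S.condExp 0 g p)) q =
      ∑ k ∈ Finset.range N, S.condExp 0
        (fun p => (S.condExp (k + 1) f p - S.condExp k f p) * (S.condExp (k + 1) g p - S.condExp k g p)) q := by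
  have hdf : ∀ k, Continuous fun p => S.condExp (k + 1) f p - S.condExp k f p :=
    fun k => (S.continuous_condExp _ hf).sub (S.continuous_condExp _ hf)
  have hdg : ∀ k, Continuous fun p => S.condExp (k + 1) g p - S.condExp k g p :=
    fun k => (S.continuous_condExp _ hg).sub (S.continuous_condExp _ hg)
  -- expand the product of the two telescoping sums
  have e : (fun p => (f p - S.condExp 0 f p) * (g p - S.condExp 0 g p)) =
      fun p => ∑ j ∈ Finset.range N, ∑ k ∈ Finset.range N,
        (S.condExp (j + 1) f p - S.condExp j f p) * (S.condExp (k + 1) g p - S.condExp k g p) := by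
    funext p
    rw [S.sub_condExp_zero_eq_sum f p, S.sub_condExp_zero_eq_sum g p, Finset.sum_mul_sum]
  rw [e, S.condExp_finset_sum 0 (Finset.range N)
    (F := fun j p => ∑ k ∈ Finset.range N,
      (S.condExp (j + 1) f p - S.condExp j f p) * (S.condExp (k + 1) g p - S.condExp k g p))
    fun j _ => continuous_finsetSum _ fun k _ => (hdf j).mul (hdg k)]
  refine Finset.sum_congr rfl fun j hj => ?_
  rw [S.condExp_finset_sum 0 (Finset.range N)
    (F := fun k p => (S.condExp (j + 1) f p - S.condExp j f p) * (S.condExp (k + 1) g p - S.condExp k g p))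
    fun k _ => (hdf j).mul (hdg k)]
  show ∑ k ∈ Finset.range N, S.condExp 0
      (fun p => (S.condExp (j + 1) f p - S.condExp j f p) * (S.condExp (k + 1) g p - S.condExp k g p)) q = _
  rw [Finset.sum_eq_single_of_mem j hj]
  intro k _ hkj
  rcases lt_or_gt_of_ne hkj with hlt | hgt
  · -- `k < j`: orthogonality with the roles exchanged
    have h := S.condExp_zero_incr_mul_incr_eq_zero hlt hg hf q
    have ecomm : (fun p => (S.condExp (j + 1) f p - S.condExp j f p) * (S.condExp (k + 1) g p - S.condExp k g p)) =
        fun p => (S.condExp (k + 1) g p - S.condExp k g p) * (S.condExp (j + 1) f p - S.condExp j f p) := by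
      funext p; ring
    rw [ecomm, h]
  · exact S.condExp_zero_incr_mul_incr_eq_zero hgt hf hg q

/-- **Variance decomposition**: `Var(f) = E_0[(f - E_0 f)²] = ∑_{k<N} E_0[(E_{k+1}f - E_k f)²]`. [folklore] -/
theorem condExp_zero_sq_centered_eq_sum {f : (Fin N → ℝ) → ℝ} (hf : Continuous f) (q : Fin N → ℝ) :
    S.condExp 0 (fun p => (f p - S.condExp 0 f p) ^ 2) q =
      ∑ k ∈ Finset.range N, S.condExp 0 (fun p => (S.condExp (k + 1) f p - S.condExp k f p) ^ 2) q := by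
  have h := S.condExp_zero_mul_centered_eq_sum hf hf q
  simp only [← sq] at h
  exact h

end Increments

/-! ### The recursion, the uniform Poincaré inequality and the decay of correlations -/

section Decay

/-- **The recursion** (the step bound integrated): for `k < N`,
`a_k ≤ A b_k + θ a_{k+1}` with `a_k = E_0[(E_{k+1}f - E_k f)²]`, `b_k = E_0[(∂_k f)²]`,
`A = 2ρ₀⁶L²`, `θ = 2ρ₀⁴(ρ₀-1)²`. [folklore] -/
theorem recursion {k : ℕ} (hk : k < N) {f : (Fin N → ℝ) → ℝ} {f' : Fin N → (Fin N → ℝ) → ℝ}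
    (hf : HasPartials f f') :
    S.condExp 0 (fun p => (S.condExp (k + 1) f p - S.condExp k f p) ^ 2) 0 ≤
      (2 * S.ratio ^ 6 * S.L ^ 2) * S.condExp 0 (fun p => f' ⟨k, hk⟩ p ^ 2) 0 +
        (2 * (S.ratio ^ 2 * (S.ratio - 1)) ^ 2) *
          S.condExp 0 (fun p => (S.condExp (k + 2) f p - S.condExp (k + 1) f p) ^ 2) 0 := by
  have hfc := hf.continuous
  have hd1 : Continuous fun p => (S.condExp (k + 1) f p - S.condExp k f p) ^ 2 :=
    ((S.continuous_condExp _ hfc).sub (S.continuous_condExp _ hfc)).pow 2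
  have hd2 : Continuous fun p => (S.condExp (k + 2) f p - S.condExp (k + 1) f p) ^ 2 :=
    ((S.continuous_condExp _ hfc).sub (S.continuous_condExp _ hfc)).pow 2
  have hb : Continuous fun p => f' ⟨k, hk⟩ p ^ 2 := (hf.continuous_partial _).pow 2
  have hstep : ∀ q, S.condExp k (fun p => (S.condExp (k + 1) f p - S.condExp k f p) ^ 2) q ≤
      (2 * S.ratio ^ 6 * S.L ^ 2) * S.condExp k (fun p => f' ⟨k, hk⟩ p ^ 2) q +
        (2 * (S.ratio ^ 2 * (S.ratio - 1)) ^ 2) *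
          S.condExp k (fun p => (S.condExp (k + 2) f p - S.condExp (k + 1) f p) ^ 2) q :=
    fun q => S.condExp_sq_increment_le hk hfc (hf.continuous_partial _) (hf.hasDerivAt ⟨k, hk⟩) q
  -- apply `E_0` and use the tower property
  have hmono := S.condExp_mono 0
    (h := S.condExp k (fun p => (S.condExp (k + 1) f p - S.condExp k f p) ^ 2))
    (h' := fun q => (2 * S.ratio ^ 6 * S.L ^ 2) * S.condExp k (fun p => f' ⟨k, hk⟩ p ^ 2) q +
        (2 * (S.ratio ^ 2 * (S.ratio - 1)) ^ 2) *
          S.condExp k (fun p => (S.condExp (k + 2) f p - S.condExp (k + 1) f p) ^ 2) q)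
    (S.continuous_condExp _ hd1)
    ((continuous_const.mul (S.continuous_condExp _ hb)).add (continuous_const.mul (S.continuous_condExp _ hd2)))
    hstep 0
  rw [S.condExp_zero_condExp k hd1] at hmono
  refine hmono.trans (le_of_eq ?_)
  have hadd := S.condExp_add 0
    (f := fun q => (2 * S.ratio ^ 6 * S.L ^ 2) * S.condExp k (fun p => f' ⟨k, hk⟩ p ^ 2) q)
    (g := fun q => (2 * (S.ratio ^ 2 * (S.ratio - 1)) ^ 2) *
      S.condExp k (fun p => (S.condExp (k + 2) f p - S.condExp (k + 1) f p) ^ 2) q)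
    (continuous_const.mul (S.continuous_condExp _ hb)) (continuous_const.mul (S.continuous_condExp _ hd2))
  have e : (fun q => (2 * S.ratio ^ 6 * S.L ^ 2) * S.condExp k (fun p => f' ⟨k, hk⟩ p ^ 2) q +
        (2 * (S.ratio ^ 2 * (S.ratio - 1)) ^ 2) *
          S.condExp k (fun p => (S.condExp (k + 2) f p - S.condExp (k + 1) f p) ^ 2) q) =
      ((fun q => (2 * S.ratio ^ 6 * S.L ^ 2) * S.condExp k (fun p => f' ⟨k, hk⟩ p ^ 2) q) +
        fun q => (2 * (S.ratio ^ 2 * (S.ratio - 1)) ^ 2) *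
          S.condExp k (fun p => (S.condExp (k + 2) f p - S.condExp (k + 1) f p) ^ 2) q) := rfl
  rw [e, hadd, Pi.add_apply, S.condExp_mul_left 0 (g := fun _ => 2 * S.ratio ^ 6 * S.L ^ 2) (fun _ _ _ => rfl),
    S.condExp_mul_left 0 (g := fun _ => 2 * (S.ratio ^ 2 * (S.ratio - 1)) ^ 2) (fun _ _ _ => rfl),
    S.condExp_zero_condExp k hb, S.condExp_zero_condExp k hd2]

/-- Increments vanish from the level `N` on. [folklore] -/
theorem incr_eq_zero_of_le {k : ℕ} (hk : N ≤ k) (f : (Fin N → ℝ) → ℝ) (p : Fin N → ℝ) :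
    S.condExp (k + 1) f p - S.condExp k f p = 0 := by
  rw [S.condExp_of_le hk, S.condExp_of_le (k := k + 1) (by omega), sub_self]

/-- Increments of a function of the first `m` coordinates vanish from the level `m` on. [folklore] -/
theorem incr_eq_zero_of_dependsOn {m k : ℕ} (hmk : m ≤ k) {f : (Fin N → ℝ) → ℝ}
    (hfm : DependsOn f {i : Fin N | i.val < m}) (p : Fin N → ℝ) :
    S.condExp (k + 1) f p - S.condExp k f p = 0 := by
  rw [S.condExp_of_dependsOn k (hfm.mono fun i hi => by simp only [Set.mem_setOf_eq] at hi ⊢; omega),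
    S.condExp_of_dependsOn (k + 1) (hfm.mono fun i hi => by simp only [Set.mem_setOf_eq] at hi ⊢; omega),
    sub_self]

/-- **Uniform Poincaré inequality (sum form)**: if `θ = 2ρ₀⁴(ρ₀-1)² < 1` then
`∑_{k<N} E_0[(E_{k+1}f - E_k f)²] ≤ (A/(1-θ)) ∑_{k<N} E_0[(∂_k f)²]`. [folklore] -/
theorem sum_condExp_zero_sq_incr_le (hθ : 2 * (S.ratio ^ 2 * (S.ratio - 1)) ^ 2 < 1)
    {f : (Fin N → ℝ) → ℝ} {f' : Fin N → (Fin N → ℝ) → ℝ} (hf : HasPartials f f') :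
    ∑ k ∈ Finset.range N, S.condExp 0 (fun p => (S.condExp (k + 1) f p - S.condExp k f p) ^ 2) 0 ≤
      (2 * S.ratio ^ 6 * S.L ^ 2) / (1 - 2 * (S.ratio ^ 2 * (S.ratio - 1)) ^ 2) *
        ∑ k : Fin N, S.condExp 0 (fun p => f' k p ^ 2) 0 := by
  set θ := 2 * (S.ratio ^ 2 * (S.ratio - 1)) ^ 2 with hθdef
  set A := 2 * S.ratio ^ 6 * S.L ^ 2 with hA
  set a : ℕ → ℝ := fun k => S.condExp 0 (fun p => (S.condExp (k + 1) f p - S.condExp k f p) ^ 2) 0 with ha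
  set b : Fin N → ℝ := fun k => S.condExp 0 (fun p => f' k p ^ 2) 0 with hb
  have ha0 : ∀ k, 0 ≤ a k := fun k => S.condExp_nonneg 0 (fun _ => sq_nonneg _) 0
  have haN : a N = 0 := by
    simp only [ha]
    have e : (fun p => (S.condExp (N + 1) f p - S.condExp N f p) ^ 2) = fun _ => 0 := by
      funext p; rw [S.incr_eq_zero_of_le le_rfl f p]; simp
    rw [e, S.condExp_const]
  have hθ0 : 0 ≤ θ := by positivity
  -- the recursion for each `k < N`
  have hrec : ∀ k (hk : k < N), a k ≤ A * b ⟨k, hk⟩ + θ * a (k + 1) := fun k hk => S.recursion hk hf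
  -- sum over `k < N`
  have hsum' : ∑ k : Fin N, a k ≤ ∑ k : Fin N, (A * b k + θ * a (k + 1)) :=
    Finset.sum_le_sum fun k _ => hrec k.val k.isLt
  rw [Finset.sum_add_distrib, ← Finset.mul_sum, ← Finset.mul_sum] at hsum'
  have e1 : ∑ k : Fin N, a k = ∑ k ∈ Finset.range N, a k := Fin.sum_univ_eq_sum_range a N
  have e2 : ∑ k : Fin N, a (k + 1) = ∑ k ∈ Finset.range N, a (k + 1) :=
    Fin.sum_univ_eq_sum_range (fun k => a (k + 1)) N
  rw [e1, e2] at hsum'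
  have hshift : ∑ k ∈ Finset.range N, a (k + 1) ≤ ∑ k ∈ Finset.range N, a k := by
    have h1 : ∑ k ∈ Finset.range (N + 1), a k = ∑ k ∈ Finset.range N, a (k + 1) + a 0 :=
      Finset.sum_range_succ' a N
    have h2 : ∑ k ∈ Finset.range (N + 1), a k = ∑ k ∈ Finset.range N, a k + a N :=
      Finset.sum_range_succ a N
    linarith [ha0 0]
  have hS0 : 0 ≤ ∑ k ∈ Finset.range N, a k := Finset.sum_nonneg fun k _ => ha0 k
  have h1 : (1 - θ) * ∑ k ∈ Finset.range N, a k ≤ A * ∑ k : Fin N, b k := by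
    nlinarith [hsum', hshift, mul_le_mul_of_nonneg_left hshift hθ0]
  rw [div_mul_eq_mul_div, le_div_iff₀ (by linarith), mul_comm]
  exact h1

end Decay

section MainBounds

/-- **Uniform Poincaré inequality**: if `θ = 2ρ₀⁴(ρ₀-1)² < 1` then for every `C¹` observable
`Var(f) = E_0[(f - E_0 f)²] ≤ (A/(1-θ)) ∑_k E_0[(∂_k f)²]`, with `A = 2ρ₀⁶L²` — uniformly in `N`
and in the observable. [folklore] -/
theorem variance_le (hθ : 2 * (S.ratio ^ 2 * (S.ratio - 1)) ^ 2 < 1)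
    {f : (Fin N → ℝ) → ℝ} {f' : Fin N → (Fin N → ℝ) → ℝ} (hf : HasPartials f f') :
    S.condExp 0 (fun p => (f p - S.condExp 0 f p) ^ 2) 0 ≤
      (2 * S.ratio ^ 6 * S.L ^ 2) / (1 - 2 * (S.ratio ^ 2 * (S.ratio - 1)) ^ 2) *
        ∑ k : Fin N, S.condExp 0 (fun p => f' k p ^ 2) 0 := by
  rw [S.condExp_zero_sq_centered_eq_sum hf.continuous]
  exact S.sum_condExp_zero_sq_incr_le hθ hf

/-- **Geometric decay of the increments of an observable of the far coordinates**: if `g`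
depends only on the coordinates `≥ l` then `a_k(g) ≤ θ^{l-k} Var(g)` for every `k`
(natural-number exponent: for `k > l` this is just `a_k ≤ Var g`). [folklore] -/
theorem condExp_zero_sq_incr_le_pow_mul
    {g : (Fin N → ℝ) → ℝ} {g' : Fin N → (Fin N → ℝ) → ℝ} (hg : HasPartials g g') {l : ℕ}
    (hgl : DependsOn g {i : Fin N | l ≤ i.val}) (k : ℕ) :
    S.condExp 0 (fun p => (S.condExp (k + 1) g p - S.condExp k g p) ^ 2) 0 ≤
      (2 * (S.ratio ^ 2 * (S.ratio - 1)) ^ 2) ^ (l - k) *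
        S.condExp 0 (fun p => (g p - S.condExp 0 g p) ^ 2) 0 := by
  set θ := 2 * (S.ratio ^ 2 * (S.ratio - 1)) ^ 2 with hθdef
  set a : ℕ → ℝ := fun k => S.condExp 0 (fun p => (S.condExp (k + 1) g p - S.condExp k g p) ^ 2) 0 with ha
  set V := S.condExp 0 (fun p => (g p - S.condExp 0 g p) ^ 2) 0 with hV
  have hθ0 : 0 ≤ θ := by positivity
  have ha0 : ∀ k, 0 ≤ a k := fun k => S.condExp_nonneg 0 (fun _ => sq_nonneg _) 0
  have haN : ∀ k, N ≤ k → a k = 0 := by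
    intro k hk
    simp only [ha]
    have e : (fun p => (S.condExp (k + 1) g p - S.condExp k g p) ^ 2) = fun _ => 0 := by
      funext p; rw [S.incr_eq_zero_of_le hk g p]; simp
    rw [e, S.condExp_const]
  have hVsum : V = ∑ k ∈ Finset.range N, a k := S.condExp_zero_sq_centered_eq_sum hg.continuous 0
  have haV : ∀ k, a k ≤ V := by
    intro k
    by_cases hk : k < N
    · rw [hVsum]
      exact Finset.single_le_sum (fun k _ => ha0 k) (Finset.mem_range.2 hk)
    · rw [haN k (not_lt.mp hk), hVsum]
      exact Finset.sum_nonneg fun k _ => ha0 k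
  -- the partial derivatives along the coordinates `< l` vanish
  have hb : ∀ (k : ℕ) (hk : k < N), k < l → S.condExp 0 (fun p => g' ⟨k, hk⟩ p ^ 2) 0 = 0 := by
    intro k hk hkl
    have hz : ∀ p, g' ⟨k, hk⟩ p = 0 := fun p =>
      hg.partial_eq_zero (hgl.mono fun i hi => by
        simp only [Set.mem_setOf_eq] at hi ⊢
        rintro rfl
        exact absurd hi (by simp only [not_le]; exact hkl)) p
    have e : (fun p => g' ⟨k, hk⟩ p ^ 2) = fun _ => 0 := by funext p; rw [hz p]; simp
    rw [e, S.condExp_const]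
  -- one-step contraction below the level `l`
  have hstep : ∀ k, k < l → a k ≤ θ * a (k + 1) := by
    intro k hkl
    by_cases hk : k < N
    · have h := S.recursion hk hg
      rw [hb k hk hkl, mul_zero, zero_add] at h
      exact h
    · rw [haN k (not_lt.mp hk)]
      exact mul_nonneg hθ0 (ha0 _)
  -- iterate
  have hiter : ∀ n k, k + n = l → a k ≤ θ ^ n * a l := by
    intro n
    induction n with
    | zero => intro k hk; simp only [add_zero] at hk; subst hk; simp
    | succ n ih =>
      intro k hk
      have hkl : k < l := by omega
      calc a k ≤ θ * a (k + 1) := hstep k hkl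
        _ ≤ θ * (θ ^ n * a l) := mul_le_mul_of_nonneg_left (ih (k + 1) (by omega)) hθ0
        _ = θ ^ (n + 1) * a l := by ring
  by_cases hkl : k ≤ l
  · calc a k ≤ θ ^ (l - k) * a l := hiter (l - k) k (by omega)
      _ ≤ θ ^ (l - k) * V := mul_le_mul_of_nonneg_left (haV l) (pow_nonneg hθ0 _)
  · rw [Nat.sub_eq_zero_of_le (by omega), pow_zero, one_mul]
    exact haV k

/-- **Decay of correlations, variance form**: for `f` depending only on the first `m`
coordinates and `g` only on the coordinates `≥ l`,
`|E_0[(f - E_0f)(g - E_0g)]| ≤ (1-θ)^{-1/2} √θ^{(l+1-m)₊} √Var(f) √Var(g)`. [folklore] -/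
theorem abs_cov_le_sqrt_var (hθ : 2 * (S.ratio ^ 2 * (S.ratio - 1)) ^ 2 < 1)
    {f g : (Fin N → ℝ) → ℝ} {f' g' : Fin N → (Fin N → ℝ) → ℝ} (hf : HasPartials f f') (hg : HasPartials g g')
    {m l : ℕ} (hfm : DependsOn f {i : Fin N | i.val < m}) (hgl : DependsOn g {i : Fin N | l ≤ i.val}) :
    |S.condExp 0 (fun p => (f p - S.condExp 0 f p) * (g p - S.condExp 0 g p)) 0| ≤
      (Real.sqrt (1 - 2 * (S.ratio ^ 2 * (S.ratio - 1)) ^ 2))⁻¹ *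
        Real.sqrt (2 * (S.ratio ^ 2 * (S.ratio - 1)) ^ 2) ^ (l + 1 - m) *
        Real.sqrt (S.condExp 0 (fun p => (f p - S.condExp 0 f p) ^ 2) 0) *
        Real.sqrt (S.condExp 0 (fun p => (g p - S.condExp 0 g p) ^ 2) 0) := by
  set θ := 2 * (S.ratio ^ 2 * (S.ratio - 1)) ^ 2 with hθdef
  have hθ0 : 0 ≤ θ := by positivity
  have hfc := hf.continuous
  have hgc := hg.continuous
  set af : ℕ → ℝ := fun k => S.condExp 0 (fun p => (S.condExp (k + 1) f p - S.condExp k f p) ^ 2) 0 with haf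
  set ag : ℕ → ℝ := fun k => S.condExp 0 (fun p => (S.condExp (k + 1) g p - S.condExp k g p) ^ 2) 0 with hag
  set Vf := S.condExp 0 (fun p => (f p - S.condExp 0 f p) ^ 2) 0 with hVf
  set Vg := S.condExp 0 (fun p => (g p - S.condExp 0 g p) ^ 2) 0 with hVg
  have haf0 : ∀ k, 0 ≤ af k := fun k => S.condExp_nonneg 0 (fun _ => sq_nonneg _) 0
  have hag0 : ∀ k, 0 ≤ ag k := fun k => S.condExp_nonneg 0 (fun _ => sq_nonneg _) 0
  have hVf0 : 0 ≤ Vf := S.condExp_nonneg 0 (fun _ => sq_nonneg _) 0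
  have hVg0 : 0 ≤ Vg := S.condExp_nonneg 0 (fun _ => sq_nonneg _) 0
  have hVfsum : Vf = ∑ k ∈ Finset.range N, af k := S.condExp_zero_sq_centered_eq_sum hfc 0
  have hsq1 : 1 ≤ (Real.sqrt (1 - θ))⁻¹ :=
    (one_le_inv₀ (Real.sqrt_pos.2 (by linarith))).2 (Real.sqrt_le_one.2 (by linarith))
  -- plain Cauchy–Schwarz
  have hCS : |S.condExp 0 (fun p => (f p - S.condExp 0 f p) * (g p - S.condExp 0 g p)) 0| ≤
      Real.sqrt Vf * Real.sqrt Vg :=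
    S.abs_condExp_mul_le 0 (hfc.sub (S.continuous_condExp _ hfc)) (hgc.sub (S.continuous_condExp _ hgc)) 0
  by_cases hml : m ≤ l + 1
  swap
  · -- overlapping supports: no decay claimed
    have hD : l + 1 - m = 0 := Nat.sub_eq_zero_of_le (by omega)
    rw [hD, pow_zero, mul_one]
    calc _ ≤ Real.sqrt Vf * Real.sqrt Vg := hCS
      _ ≤ (Real.sqrt (1 - θ))⁻¹ * Real.sqrt Vf * Real.sqrt Vg := by
          rw [mul_assoc]
          exact le_mul_of_one_le_left (mul_nonneg (Real.sqrt_nonneg _) (Real.sqrt_nonneg _)) hsq1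
  -- separated supports: `m ≤ l + 1`, gap `D = l + 1 - m`
  set D := l + 1 - m with hD
  -- the correlation of the `k`-th increments, nonzero only for `k < m`
  set c : ℕ → ℝ := fun k => S.condExp 0
    (fun p => (S.condExp (k + 1) f p - S.condExp k f p) * (S.condExp (k + 1) g p - S.condExp k g p)) 0 with hc
  have hcov : S.condExp 0 (fun p => (f p - S.condExp 0 f p) * (g p - S.condExp 0 g p)) 0 =
      ∑ k ∈ Finset.range N, c k := S.condExp_zero_mul_centered_eq_sum hfc hgc 0
  have hc0 : ∀ k, m ≤ k → c k = 0 := by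
    intro k hk
    simp only [hc]
    have e : (fun p => (S.condExp (k + 1) f p - S.condExp k f p) * (S.condExp (k + 1) g p - S.condExp k g p)) =
        fun _ => 0 := by
      funext p; rw [S.incr_eq_zero_of_dependsOn hk hfm p]; simp
    rw [e, S.condExp_const]
  -- weights `w_k = √θ^{m-1-k}` for `k < m`, `0` otherwise
  set w : ℕ → ℝ := fun k => if k < m then Real.sqrt θ ^ (m - 1 - k) else 0 with hw
  have hw0 : ∀ k, 0 ≤ w k := fun k => by
    simp only [hw]; split_ifs
    · positivity
    · exact le_rfl
  -- termwise Cauchy–Schwarz and decay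
  have hsqθ : ∀ n : ℕ, Real.sqrt (θ ^ n) = Real.sqrt θ ^ n := fun n => by
    rw [Real.sqrt_eq_iff_mul_self_eq (pow_nonneg hθ0 n) (pow_nonneg (Real.sqrt_nonneg θ) n), ← mul_pow,
      Real.mul_self_sqrt hθ0]
  have hterm : ∀ k, |c k| ≤ Real.sqrt θ ^ D * Real.sqrt Vg * (Real.sqrt (af k) * w k) := by
    intro k
    by_cases hk : k < m
    · have h1 := S.abs_condExp_mul_le 0 (X := fun p => S.condExp (k + 1) f p - S.condExp k f p)
        (Y := fun p => S.condExp (k + 1) g p - S.condExp k g p)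
        ((S.continuous_condExp _ hfc).sub (S.continuous_condExp _ hfc))
        ((S.continuous_condExp _ hgc).sub (S.continuous_condExp _ hgc)) 0
      have h2 := S.condExp_zero_sq_incr_le_pow_mul hg hgl k
      have hlk : l - k = D + (m - 1 - k) := by omega
      have hwk : w k = Real.sqrt θ ^ (m - 1 - k) := by simp only [hw, if_pos hk]
      have h3 : Real.sqrt (ag k) ≤ Real.sqrt θ ^ D * Real.sqrt θ ^ (m - 1 - k) * Real.sqrt Vg := by
        calc Real.sqrt (ag k) ≤ Real.sqrt (θ ^ (l - k) * Vg) := Real.sqrt_le_sqrt h2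
          _ = Real.sqrt θ ^ D * Real.sqrt θ ^ (m - 1 - k) * Real.sqrt Vg := by
              rw [Real.sqrt_mul (pow_nonneg hθ0 _), hsqθ, hlk, pow_add]
      calc |c k| ≤ Real.sqrt (af k) * Real.sqrt (ag k) := h1
        _ ≤ Real.sqrt (af k) * (Real.sqrt θ ^ D * Real.sqrt θ ^ (m - 1 - k) * Real.sqrt Vg) :=
            mul_le_mul_of_nonneg_left h3 (Real.sqrt_nonneg _)
        _ = Real.sqrt θ ^ D * Real.sqrt Vg * (Real.sqrt (af k) * w k) := by rw [hwk]; ring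
    · rw [hc0 k (not_lt.mp hk), abs_zero]
      exact mul_nonneg (by positivity) (mul_nonneg (Real.sqrt_nonneg _) (hw0 k))
  -- the geometric sum of the squared weights
  have hwsum : ∑ k ∈ Finset.range N, w k ^ 2 ≤ (1 - θ)⁻¹ := by
    have e1 : ∀ k ∈ Finset.range N, w k ^ 2 = if k < m then θ ^ (m - 1 - k) else 0 := by
      intro k _
      simp only [hw]
      split_ifs
      · rw [← pow_mul, mul_comm, pow_mul, Real.sq_sqrt hθ0]
      · simp
    rw [Finset.sum_congr rfl e1, ← Finset.sum_filter]
    calc ∑ k ∈ (Finset.range N).filter (fun k => k < m), θ ^ (m - 1 - k)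
        ≤ ∑ k ∈ Finset.range m, θ ^ (m - 1 - k) := by
          refine Finset.sum_le_sum_of_subset_of_nonneg (fun k hk => ?_) fun k _ _ => pow_nonneg hθ0 _
          simp only [Finset.mem_filter, Finset.mem_range] at hk ⊢
          exact hk.2
      _ = ∑ j ∈ Finset.range m, θ ^ j := Finset.sum_range_reflect (fun j => θ ^ j) m
      _ ≤ ∑' j, θ ^ j := (summable_geometric_of_lt_one hθ0 hθ).sum_le_tsum (Finset.range m)
          fun j _ => pow_nonneg hθ0 j
      _ = (1 - θ)⁻¹ := tsum_geometric_of_lt_one hθ0 hθ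
  -- Cauchy–Schwarz in `k`
  have hCSk : ∑ k ∈ Finset.range N, Real.sqrt (af k) * w k ≤ Real.sqrt Vf * (Real.sqrt (1 - θ))⁻¹ := by
    have hcs := Finset.sum_mul_sq_le_sq_mul_sq (Finset.range N) (fun k => Real.sqrt (af k)) w
    have e1 : ∑ k ∈ Finset.range N, Real.sqrt (af k) ^ 2 = Vf := by
      rw [hVfsum]; exact Finset.sum_congr rfl fun k _ => Real.sq_sqrt (haf0 k)
    rw [e1] at hcs
    have hx0 : 0 ≤ ∑ k ∈ Finset.range N, Real.sqrt (af k) * w k :=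
      Finset.sum_nonneg fun k _ => mul_nonneg (Real.sqrt_nonneg _) (hw0 k)
    calc ∑ k ∈ Finset.range N, Real.sqrt (af k) * w k
        = Real.sqrt ((∑ k ∈ Finset.range N, Real.sqrt (af k) * w k) ^ 2) := (Real.sqrt_sq hx0).symm
      _ ≤ Real.sqrt (Vf * (1 - θ)⁻¹) :=
          Real.sqrt_le_sqrt (hcs.trans (mul_le_mul_of_nonneg_left hwsum hVf0))
      _ = Real.sqrt Vf * (Real.sqrt (1 - θ))⁻¹ := by rw [Real.sqrt_mul hVf0, Real.sqrt_inv]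
  -- sum up
  calc |S.condExp 0 (fun p => (f p - S.condExp 0 f p) * (g p - S.condExp 0 g p)) 0|
      = |∑ k ∈ Finset.range N, c k| := by rw [hcov]
    _ ≤ ∑ k ∈ Finset.range N, |c k| := Finset.abs_sum_le_sum_abs _ _
    _ ≤ ∑ k ∈ Finset.range N, Real.sqrt θ ^ D * Real.sqrt Vg * (Real.sqrt (af k) * w k) :=
        Finset.sum_le_sum fun k _ => hterm k
    _ = Real.sqrt θ ^ D * Real.sqrt Vg * ∑ k ∈ Finset.range N, Real.sqrt (af k) * w k := by
        rw [Finset.mul_sum]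
    _ ≤ Real.sqrt θ ^ D * Real.sqrt Vg * (Real.sqrt Vf * (Real.sqrt (1 - θ))⁻¹) :=
        mul_le_mul_of_nonneg_left hCSk (by positivity)
    _ = (Real.sqrt (1 - θ))⁻¹ * Real.sqrt θ ^ D * Real.sqrt Vf * Real.sqrt Vg := by ring

end MainBounds

end Spec

end BoxChain

end Literature.Probability.LatticeModels

end
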